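import Summits.ResolutionOfSingularities.ResolutionOfSingularities.Theorems.PurelyInseparableDim4IsolationWitness
import Summits.ResolutionOfSingularities.ResolutionOfSingularities.Theorems.PurelyInseparableDim4Rules
import Literature.AlgebraicGeometry.Resolution.CentreBlowupOrdAlongBasics
import HarnessLib

/-!
# [OURS · res-dim4-pi PR-10, part 5] At an ISOLATED `q`-fold point the POINT is the only Hironaka-permissible
  coordinate centre: every MODE (1h / 2 / rule `R`) is MODE 0 there, and F4-I transfers to every rule

Cell `res-dim4-pi` (D-0157 DOOR 2), PR-10 fifth file (seat `res-dim4-p-3`); sequel of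
`PurelyInseparableDim4IsolationWitness.lean`, over the Target / Rules / Scope files of the frame
(`IsPermissibleCentre q S F = S ≠ ∅ ∧ q ≤ ord_{(x_S)} F`, `IsMode1hCentre`, `Edge`, `Step0/Step1h/Step2`,
`StepRule R`, `IsIsolated`, `NoIsolatedTrap`).  WORD #20 (c) states the ISOLATED regime as «states with
`Sing_q(z^q + F) = {0}` locally — there the ONLY Hironaka-permissible centre is the point, for everybody,
so PT edges at isolated states are bona-fide DOOR-2 content».  This file proves the coordinate-centre half
of that sentence inside the frame.

## What is proved (field `K`, any `q`)

* `hasseDeriv_mem_span_X_image_of_le_ordAlong`: if `q ≤ ord_{(x_S)} F` (i.e. `F ∈ (x_S)^q`) then every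
  Hasse derivative `D^{(α)}F` with `|α| < q` lies in the coordinate ideal `(x_S)` (each monomial `x^{d−α}`,
  `α ≤ d`, keeps `Σ_{i∈S}(dᵢ − αᵢ) ≥ q − |α| ≥ 1`); hence `singLocusIdeal_le_span_X_image_of_le_ordAlong`:
  `J_q⁺(F) ≤ (x_S)`.
* `eval_zero_killVars`, **`not_isIsolated_of_isPermissibleCentre_of_ne_univ`**: a Hironaka-permissible
  coordinate centre `V(z, x_S)` with `S ≠ univ` (positive-dimensional) refutes isolation — kernel witness
  `φ_S : xᵢ ↦ 0 (i ∈ S), xᵢ ↦ xᵢ (i ∉ S)` into the domain `K[x]` (`not_isIsolated_of_ringHom`).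
* **`eq_univ_of_isIsolated_of_isPermissibleCentre`**: `IsIsolated q F → IsPermissibleCentre q S F →
  S = univ` — at an isolated state the point is the only permissible coordinate centre; corollaries
  `eq_univ_of_isIsolated_of_isMode1hCentre`, **`step0_of_step1h_of_isIsolated`**,
  `step0_of_step2_of_isIsolated`, `step0_of_stepRule_of_isIsolated` (every mode is MODE 0 there).
* **`noIsolatedTrap_transfer`**: `NoIsolatedTrap p q` (F4-I, stated with `Step0`) already forbids an
  infinite branch of isolated states under `Step1h`, `Step2`, or ANY coordinate rule `StepRule R`
  (`no_isolated_step1h_branch`, `no_isolated_step2_branch`, `no_isolated_stepRule_branch`).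

[OURS · counted 0 · elementary; AI kernel work, weaker than expert review.]  The converse half of WORD #20 (c)
(«the point is permissible for Hironaka's A too», non-coordinate regular centres) is not a frame statement
and is not touched.  Nothing here is a statement about resolution of singularities; resolution in dimension
`≥ 4` / characteristic `p > 0` is NOT proved by anything in this file.  Host item (DR-157-C):
`stmt-ResolutionOfSingularities-16155`, helper.
-/

noncomputable section

set_option linter.dupNamespace false -- mandated namespace of this single-conjunct summit

open MvPolynomial Finset
open scoped BigOperators

namespace Summit.ResolutionOfSingularities.ResolutionOfSingularities.Theorems.PIDim4.IsolationCert

open Literature.AlgebraicGeometry.Resolution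
open Literature.AlgebraicGeometry.Resolution.CentreBlowup

/-! ## §1 `F ∈ (x_S)^q` puts every `D^{(α)}F`, `|α| < q`, into `(x_S)` -/

/-- **Hasse derivatives of order `< q` of an `F` with `ord_{(x_S)} F ≥ q` lie in `(x_S)`.** Each summand
`(∏ C(dᵢ, αᵢ))·c_d · x^{d − α}` of `D^{(α)}F` is either `0` (some `αᵢ > dᵢ`) or has
`Σ_{i∈S} (d − α)ᵢ ≥ Σ_{i∈S} dᵢ − |α| ≥ q − |α| > 0`, so some `S`-variable divides it. OURS (elementary).
[cite: Giraud1975, §1 (Hasse–Schmidt derivations)] -/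
theorem hasseDeriv_mem_span_X_image_of_le_ordAlong {K : Type} [Field K] {q : ℕ} {S : Finset (Fin 4)}
    {F : MvPolynomial (Fin 4) K} (hF : (q : ℕ∞) ≤ ordAlong S F) (α : Fin 4 →₀ ℕ) (hα : α.degree < q) :
    hasseDeriv α F ∈ Ideal.span ((fun i => (X i : MvPolynomial (Fin 4) K)) '' (S : Set (Fin 4))) := by
  unfold hasseDeriv
  refine Ideal.sum_mem _ fun d hd => ?_
  by_cases hle : α ≤ d
  · -- some `S`-variable survives in `d - α`
    have hq : q ≤ degIn S d := by exact_mod_cast (le_ordAlong_iff.mp hF) d hd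
    have hαS : degIn S α ≤ α.degree := by
      rw [Finsupp.degree_eq_sum]
      exact Finset.sum_le_sum_of_subset_of_nonneg (Finset.subset_univ S) fun _ _ _ => Nat.zero_le _
    have hsum : degIn S (d - α) + degIn S α = degIn S d := by
      unfold degIn
      rw [← Finset.sum_add_distrib]
      exact Finset.sum_congr rfl fun i _ => by
        rw [Finsupp.tsub_apply]; exact Nat.sub_add_cancel (hle i)
    obtain ⟨i, hiS, hi⟩ : ∃ i ∈ S, (d - α) i ≠ 0 := by
      by_contra hc
      push Not at hc
      have : degIn S (d - α) = 0 := Finset.sum_eq_zero hc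
      omega
    rw [MvPolynomial.mem_ideal_span_X_image]
    intro m hm
    classical
    rw [MvPolynomial.support_monomial] at hm
    split_ifs at hm with h0
    · exact absurd hm (Finset.notMem_empty m)
    · rw [Finset.mem_singleton] at hm
      subst hm
      exact ⟨i, hiS, hi⟩
  · -- a vanishing binomial coefficient
    obtain ⟨i, hi⟩ : ∃ i, d i < α i := by
      by_contra hc
      push Not at hc
      exact hle fun i => hc i
    have hzero : (∏ k, ((d k).choose (α k) : K)) = 0 :=
      Finset.prod_eq_zero (Finset.mem_univ i) (by rw [Nat.choose_eq_zero_of_lt hi, Nat.cast_zero])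
    rw [hzero, zero_mul, map_zero]
    exact Ideal.zero_mem _

/-- Hence **`J_q⁺(F) ≤ (x_S)` whenever `V(z, x_S)` is in the `q`-fold locus** (`q ≤ ord_{(x_S)} F`).
OURS (elementary). [cite: HauserPerlega2019PRIMS, §2 (condition (1) f ∈ P^{c!})] -/
theorem singLocusIdeal_le_span_X_image_of_le_ordAlong {K : Type} [Field K] {q : ℕ} {S : Finset (Fin 4)}
    {F : MvPolynomial (Fin 4) K} (hF : (q : ℕ∞) ≤ ordAlong S F) :
    singLocusIdeal q F ≤ Ideal.span ((fun i => (X i : MvPolynomial (Fin 4) K)) '' (S : Set (Fin 4))) := by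
  unfold singLocusIdeal
  rw [Ideal.span_le]
  rintro _ ⟨α, -, hq, rfl⟩
  exact hasseDeriv_mem_span_X_image_of_le_ordAlong hF α hq

/-! ## §2 A positive-dimensional permissible coordinate centre refutes isolation -/

/-- Killing the `S`-variables and then evaluating at `0` is evaluating at `0`. OURS (bookkeeping).
[cite: AtiyahMacdonald1969, Ch. 1 Ex. 1.1 (the ideal (x₁,…,xₙ))] -/
theorem eval_zero_killVars {K : Type} [Field K] (S : Finset (Fin 4)) (g : MvPolynomial (Fin 4) K) :
    MvPolynomial.eval (0 : Fin 4 → K)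
      (MvPolynomial.aeval (fun i => if i ∈ S then (0 : MvPolynomial (Fin 4) K) else X i) g) =
      MvPolynomial.eval (0 : Fin 4 → K) g := by
  have hcomp : (MvPolynomial.eval (0 : Fin 4 → K)).comp
      (MvPolynomial.aeval (fun i => if i ∈ S then (0 : MvPolynomial (Fin 4) K) else X i) :
        MvPolynomial (Fin 4) K →ₐ[K] MvPolynomial (Fin 4) K).toRingHom =
        MvPolynomial.eval (0 : Fin 4 → K) := by
    refine MvPolynomial.ringHom_ext (fun a => ?_) (fun k => ?_)
    · simp
    · by_cases hk : k ∈ S <;> simp [hk]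
  exact congrArg (fun f : MvPolynomial (Fin 4) K →+* K => f g) hcomp

/-- **A Hironaka-permissible coordinate centre of positive dimension refutes isolation.** If
`q ≤ ord_{(x_S)} F` and `S ≠ univ` then `¬ IsIsolated q F`: `J_q⁺(F) ≤ (x_S) ⊆ ker φ_S`, `φ_S` the map
killing the `S`-variables (a prime inside `𝔪₀`, missing `xᵢ` for `i ∉ S`). OURS (elementary).
[cite: HauserPerlega2019PRIMS, §2 (permissible blowups)] -/
theorem not_isIsolated_of_le_ordAlong_of_ne_univ {K : Type} [Field K] {q : ℕ} {S : Finset (Fin 4)}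
    {F : MvPolynomial (Fin 4) K} (hF : (q : ℕ∞) ≤ ordAlong S F) (hS : S ≠ Finset.univ) :
    ¬ IsIsolated q F := by
  obtain ⟨i, -, hi⟩ : ∃ i ∈ (Finset.univ : Finset (Fin 4)), i ∉ S := by
    by_contra hc
    push Not at hc
    exact hS (Finset.eq_univ_of_forall fun i => hc i (Finset.mem_univ i))
  have hJ := singLocusIdeal_le_span_X_image_of_le_ordAlong hF
  refine not_isIsolated_of_ringHom
    (MvPolynomial.aeval (fun i => if i ∈ S then (0 : MvPolynomial (Fin 4) K) else X i) :
      MvPolynomial (Fin 4) K →ₐ[K] MvPolynomial (Fin 4) K).toRingHom (fun α h0 hq => ?_)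
    (fun g hg => ?_) (i := i) ?_
  · -- `D^{(α)}F ∈ (x_S)` is killed
    have hmem : hasseDeriv α F ∈
        Ideal.span ((fun i => (X i : MvPolynomial (Fin 4) K)) '' (S : Set (Fin 4))) :=
      hJ (Ideal.subset_span ⟨α, h0, hq, rfl⟩)
    have hker : Ideal.span ((fun i => (X i : MvPolynomial (Fin 4) K)) '' (S : Set (Fin 4))) ≤
        RingHom.ker (MvPolynomial.aeval
          (fun i => if i ∈ S then (0 : MvPolynomial (Fin 4) K) else X i) :
            MvPolynomial (Fin 4) K →ₐ[K] MvPolynomial (Fin 4) K).toRingHom := by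
      rw [Ideal.span_le]
      rintro _ ⟨k, hk, rfl⟩
      rw [SetLike.mem_coe, RingHom.mem_ker]
      change MvPolynomial.aeval _ (X k) = 0
      rw [MvPolynomial.aeval_X, if_pos (Finset.mem_coe.mp hk)]
    exact (RingHom.mem_ker).mp (hker hmem)
  · rw [← eval_zero_killVars S g]
    rw [show MvPolynomial.aeval (fun i => if i ∈ S then (0 : MvPolynomial (Fin 4) K) else X i) g = 0
      from hg, map_zero]
  · change MvPolynomial.aeval (fun i => if i ∈ S then (0 : MvPolynomial (Fin 4) K) else X i)
      (X i : MvPolynomial (Fin 4) K) ≠ 0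
    rw [MvPolynomial.aeval_X, if_neg hi]
    exact MvPolynomial.X_ne_zero i

/-! ## §3 At an isolated state the point is the only permissible coordinate centre -/

/-- **At an ISOLATED `q`-fold point the only Hironaka-permissible coordinate centre is the point**
(`S = univ`). OURS (the coordinate half of WORD #20 (c)). [cite: HauserPerlega2019PRIMS, §2 (permissible blowups)] -/
theorem eq_univ_of_isIsolated_of_isPermissibleCentre {K : Type} [Field K] {q : ℕ} {S : Finset (Fin 4)}
    {F : MvPolynomial (Fin 4) K} (hI : IsIsolated q F) (hP : IsPermissibleCentre q S F) :
    S = Finset.univ := by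
  by_contra hS
  exact not_isIsolated_of_le_ordAlong_of_ne_univ hP.2 hS hI

/-- … in particular every MODE-1h centre of an isolated state is the point. OURS.
[cite: HauserPerlega2019PRIMS, §2 (permissible blowups)] -/
theorem eq_univ_of_isIsolated_of_isMode1hCentre {K : Type} [Field K] {q : ℕ} {S : Finset (Fin 4)}
    {F : MvPolynomial (Fin 4) K} (hI : IsIsolated q F) (h1h : IsMode1hCentre q S F) :
    S = Finset.univ :=
  eq_univ_of_isIsolated_of_isPermissibleCentre hI h1h.1

/-- **MODE 1h = MODE 0 at isolated states.** OURS. [cite: HauserPerlega2019PRIMS, §2 (permissible blowups)] -/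
theorem step0_of_step1h_of_isIsolated {K : Type} [Field K] [DecidableEq K] {q : ℕ} {s s' : State K}
    (hI : IsIsolated q s.F) (h : Step1h q s s') : Step0 q s s' := by
  obtain ⟨S, h1h, he⟩ := h
  obtain rfl := eq_univ_of_isIsolated_of_isMode1hCentre hI h1h
  exact ⟨h1h.1.2, he⟩

/-- **MODE 2 = MODE 0 at isolated states.** OURS. [cite: HauserPerlega2019PRIMS, §2 (permissible blowups)] -/
theorem step0_of_step2_of_isIsolated {K : Type} [Field K] [DecidableEq K] {q : ℕ} {s s' : State K}
    (hI : IsIsolated q s.F) (h : Step2 q s s') : Step0 q s s' := by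
  obtain ⟨S, hP, he⟩ := h
  obtain rfl := eq_univ_of_isIsolated_of_isPermissibleCentre hI hP
  exact ⟨hP.2, he⟩

/-- **Every coordinate rule steps through the point at isolated states.** OURS.
[cite: HauserPerlega2019PRIMS, §2 (permissible blowups)] -/
theorem step0_of_stepRule_of_isIsolated {K : Type} [Field K] [DecidableEq K] {q : ℕ} (R : CentreRule K)
    {s s' : State K} (hI : IsIsolated q s.F) (h : StepRule q R s s') : Step0 q s s' := by
  obtain ⟨hP, he⟩ := h
  have hR : R s = Finset.univ := eq_univ_of_isIsolated_of_isPermissibleCentre hI hP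
  refine ⟨?_, ?_⟩
  · have := hP.2; rwa [hR] at this
  · rwa [hR] at he

/-! ## §4 F4-I transfers to every coordinate rule -/

/-- **F4-I forbids isolated MODE-1h branches.** OURS. [cite: HauserPerlega2019PRIMS, §2 (permissible blowups)] -/
theorem no_isolated_step1h_branch {p q : ℕ} (h : NoIsolatedTrap p q) (K : Type) [Field K] [CharP K p]
    [DecidableEq K] : ¬ ∃ c : ℕ → State K, ∀ k, IsIsolated q (c k).F ∧ Step1h q (c k) (c (k + 1)) := by
  rintro ⟨c, hc⟩
  exact h K ⟨c, fun k => ⟨(hc k).1, step0_of_step1h_of_isIsolated (hc k).1 (hc k).2⟩⟩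

/-- **F4-I forbids isolated MODE-2 branches.** OURS. [cite: HauserPerlega2019PRIMS, §2 (permissible blowups)] -/
theorem no_isolated_step2_branch {p q : ℕ} (h : NoIsolatedTrap p q) (K : Type) [Field K] [CharP K p]
    [DecidableEq K] : ¬ ∃ c : ℕ → State K, ∀ k, IsIsolated q (c k).F ∧ Step2 q (c k) (c (k + 1)) := by
  rintro ⟨c, hc⟩
  exact h K ⟨c, fun k => ⟨(hc k).1, step0_of_step2_of_isIsolated (hc k).1 (hc k).2⟩⟩

/-- **F4-I forbids isolated branches of ANY coordinate rule `R`.** OURS.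
[cite: HauserPerlega2019PRIMS, §2 (permissible blowups)] -/
theorem no_isolated_stepRule_branch {p q : ℕ} (h : NoIsolatedTrap p q) (K : Type) [Field K] [CharP K p]
    [DecidableEq K] (R : CentreRule K) :
    ¬ ∃ c : ℕ → State K, ∀ k, IsIsolated q (c k).F ∧ StepRule q R (c k) (c (k + 1)) := by
  rintro ⟨c, hc⟩
  exact h K ⟨c, fun k => ⟨(hc k).1, step0_of_stepRule_of_isIsolated R (hc k).1 (hc k).2⟩⟩

end Summit.ResolutionOfSingularities.ResolutionOfSingularities.Theorems.PIDim4.IsolationCert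

end
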